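import Mathlib.NumberTheory.Padics.RingHoms
import Literature.NumberTheory.QuadraticForms.PadicSquares
import HarnessLib

/-!
# Square classes of integers in `ℚ₃` (team n1011, row T-LOC3T, FILE C1)

HONEST FRAMING (cell `b2b-bsdres`, run/shared/lean/b2b/bsd-rank1-residual/, verbatim in every
file): the goal of the cell is to DELETE the COMBINATION-SHAPED residual classes of the
Birch–Swinnerton-Dyer formula for ALL analytic-rank `≤ 1` elliptic curves over `ℚ` — "full BSD
formula for every rank `≤ 1` curve in class `C`" assembled STRICTLY from published theorems — so
that the rank-`≤ 1` remainder becomes exactly the CONSTRUCTION-SHAPED classes, which are TYPED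
(missing-input `Prop`s), NOT attempted. This is not "finishing BSD". Team n1011 (N10/N11, route
(a) at `p = 3`): research route; this file is a TOOL; nothing is booked by it; no mark / label
moved; X4 stays CONSTRUCTION-SHAPED. THEOREMS ONLY: no definition, no named fact, no `sorry`.

## What

* `isSquare_of_norm_sub_one_lt_one` — an element of `ℚ₃` within distance `< 1` of `1` is a square
  (odd-`p` Hensel; the tree's `padicInt_isSquare_of_toZMod_eq_one`).
* `isSquare_iff_of_norm_sub_le` — if `‖G - c‖ ≤ 3⁻¹‖c‖`, `c ≠ 0`, then `G ≠ 0` and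
  `G` is a square iff `c` is (the square class is locally constant).
* **`isSquare_intCast_padic_three_iff`** — an integer `n = 3^w · u`, `3 ∤ u`, is a square in `ℚ₃`
  iff `w` is even and `u ≡ 1 (mod 3)` (Serre, *A Course in Arithmetic*, Ch. II §3.3, Thm 3 and
  its corollary on `ℚ_p^× / ℚ_p^{×2}`, `p` odd).

Consumer: FILE C2 `LocalThreeTorsionDecider` (the square class of `g(zᵢ)` at a Hensel root `zᵢ`
of `Ψ₃` is read at the certified approximation `cᵢ`). References: [Serre1973] Ch. II §3.3.
-/

set_option autoImplicit false

noncomputable section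

open scoped Classical
open Literature.NumberTheory.QuadraticForms

namespace Summit.BirchSwinnertonDyer.Rank1Residual.GaloisImage.LocalTorsion3

/-! ### Square classes in `ℚ₃` -/

/-- An element of `ℚ₃` at distance `< 1` from `1` is a square (odd-`p` Hensel: a `3`-adic unit
`≡ 1 (mod 3)` is a square). [cite: Serre1973, Ch. II §3.3 Thm 3] -/
theorem isSquare_of_norm_sub_one_lt_one {u : ℚ_[3]} (hu : ‖u - 1‖ < 1) : IsSquare u := by
  have hun : ‖u‖ ≤ 1 := by
    have : u = (u - 1) + 1 := by ring
    rw [this]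
    exact (Padic.nonarchimedean _ _).trans (max_le hu.le (by simp))
  set U : ℤ_[3] := ⟨u, hun⟩ with hU
  have hU1 : ‖U - 1‖ < 1 := hu
  have hmem : U - 1 ∈ IsLocalRing.maximalIdeal ℤ_[3] := by
    rw [IsLocalRing.mem_maximalIdeal, PadicInt.mem_nonunits]; exact hU1
  have hz : PadicInt.toZMod U = 1 := by
    rw [← PadicInt.ker_toZMod, RingHom.mem_ker, map_sub, map_one, sub_eq_zero] at hmem
    exact hmem
  obtain ⟨s, hs⟩ := padicInt_isSquare_of_toZMod_eq_one (p := 3) (by decide) hz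
  exact ⟨(s : ℚ_[3]), by rw [← PadicInt.coe_mul, ← hs]⟩

/-- If `‖G - c‖ ≤ 3⁻¹ ‖c‖` and `c ≠ 0` then `G = c · u` with `u` a square unit; hence `G ≠ 0` and
`G` is a square iff `c` is. [folklore] -/
theorem isSquare_iff_of_norm_sub_le {G c : ℚ_[3]} (hc : c ≠ 0) (h : ‖G - c‖ ≤ 3⁻¹ * ‖c‖) :
    G ≠ 0 ∧ (IsSquare G ↔ IsSquare c) := by
  have hcn : 0 < ‖c‖ := norm_pos_iff.mpr hc
  set u := G / c with hu
  have hG : G = c * u := by rw [hu, mul_div_cancel₀ _ hc]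
  have hu1 : ‖u - 1‖ < 1 := by
    have : u - 1 = (G - c) / c := by rw [hu]; field_simp
    rw [this, norm_div, div_lt_one hcn]
    exact h.trans_lt (by nlinarith)
  obtain ⟨s, hs⟩ := isSquare_of_norm_sub_one_lt_one hu1
  have hu0 : u ≠ 0 := by
    intro h0; rw [h0, zero_sub, norm_neg, norm_one] at hu1; exact lt_irrefl _ hu1
  have hs0 : s ≠ 0 := fun h0 => hu0 (by rw [hs, h0, mul_zero])
  refine ⟨by rw [hG]; exact mul_ne_zero hc hu0, ⟨fun ⟨r, hr⟩ => ?_, fun ⟨r, hr⟩ => ?_⟩⟩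
  · refine ⟨r / s, ?_⟩
    have : c = G / u := by rw [hG, mul_div_cancel_right₀ _ hu0]
    rw [this, hr, hs]; field_simp
  · exact ⟨r * s, by rw [hG, hr, hs]; ring⟩

/-- The `3`-adic norm of an integer with `3^w ∥ n` is `3^{-w}`. [folklore] -/
theorem norm_intCast_padic_eq {n : ℤ} {w : ℕ} (hw : (3 : ℤ) ^ w ∣ n)
    (hw' : ¬ (3 : ℤ) ^ (w + 1) ∣ n) :
    ‖(n : ℚ_[3])‖ = (3 : ℝ) ^ (-(w : ℤ)) := by
  have hle : ‖(n : ℚ_[3])‖ ≤ (3 : ℝ) ^ (-(w : ℤ)) := by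
    exact_mod_cast (Padic.norm_int_le_pow_iff_dvd n w).mpr hw
  refine le_antisymm hle (le_of_not_gt fun hlt => hw' ?_)
  have hexp : (-((w + 1 : ℕ) : ℤ)) + 1 = -(w : ℤ) := by push_cast; ring
  have : ‖(n : ℚ_[3])‖ ≤ ((3 : ℕ) : ℝ) ^ (-((w + 1 : ℕ) : ℤ)) := by
    rw [Padic.norm_le_pow_iff_norm_lt_pow_add_one, hexp]; exact_mod_cast hlt
  exact_mod_cast (Padic.norm_int_le_pow_iff_dvd n (w + 1)).mp this

/-- In `ZMod 3` a non-zero element squares to `1`. [folklore] -/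
theorem sq_eq_one_of_ne_zero_zmod_three (a : ZMod 3) (ha : a ≠ 0) : a ^ 2 = 1 := by
  revert a; decide

/-- A `3`-adic unit of `ℚ₃` which is a square is `≡ 1 (mod 3)`: `‖r² - 1‖ < 1` when `‖r‖ = 1`.
[cite: Serre1973, Ch. II §3.3 Thm 3] -/
theorem norm_sq_sub_one_lt_one {r : ℚ_[3]} (hr : ‖r‖ = 1) : ‖r ^ 2 - 1‖ < 1 := by
  set R : ℤ_[3] := ⟨r, hr.le⟩ with hR
  have hRu : PadicInt.toZMod R ≠ 0 := by
    intro h0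
    have : R ∈ RingHom.ker (PadicInt.toZMod (p := 3)) := h0
    rw [PadicInt.ker_toZMod, IsLocalRing.mem_maximalIdeal, PadicInt.mem_nonunits] at this
    exact absurd hr (ne_of_lt this)
  have h1 : PadicInt.toZMod (R ^ 2 - 1) = 0 := by
    rw [map_sub, map_pow, map_one, sq_eq_one_of_ne_zero_zmod_three _ hRu, sub_self]
  have hmem : R ^ 2 - 1 ∈ IsLocalRing.maximalIdeal ℤ_[3] := by
    rw [← PadicInt.ker_toZMod]; exact h1
  rw [IsLocalRing.mem_maximalIdeal, PadicInt.mem_nonunits] at hmem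
  exact hmem

/-- **Square classes of integers in `ℚ₃`.** For an integer `n = 3^w · u` with `3 ∤ u`:
`n` is a square in `ℚ₃` iff `w` is even and `u ≡ 1 (mod 3)`. [cite: Serre1973, Ch. II §3.3] -/
theorem isSquare_intCast_padic_three_iff (n : ℤ) (w : ℕ) (hw : (3 : ℤ) ^ w ∣ n)
    (hw' : ¬ (3 : ℤ) ^ (w + 1) ∣ n) :
    IsSquare (n : ℚ_[3]) ↔ (w % 2 = 0 ∧ (n / 3 ^ w) % 3 = 1) := by
  obtain ⟨u, hu⟩ := hw
  have h3w : (3 : ℤ) ^ w ≠ 0 := pow_ne_zero _ (by norm_num)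
  have hdiv : n / 3 ^ w = u := by rw [hu, Int.mul_ediv_cancel_left _ h3w]
  have hu3 : ¬ (3 : ℤ) ∣ u := by
    rintro ⟨v, rfl⟩; exact hw' ⟨v, by rw [hu]; ring⟩
  have hn0 : (n : ℚ_[3]) ≠ 0 := by
    have : n ≠ 0 := by rintro rfl; exact hw' (dvd_zero _)
    exact_mod_cast this
  have hnorm_u : ‖(u : ℚ_[3])‖ = 1 := by
    have := norm_intCast_padic_eq (n := u) (w := 0) (by simp) (by simpa using hu3)
    simpa using this
  rw [hdiv]
  constructor
  · rintro ⟨s, hs⟩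
    have hs0 : s ≠ 0 := fun h0 => hn0 (by rw [hs, h0, mul_zero])
    -- valuation: `‖n‖ = 3^{-w} = ‖s‖²`, and `‖s‖ = 3^{-v}`
    have hnn : ‖(n : ℚ_[3])‖ = (3 : ℝ) ^ (-(w : ℤ)) := norm_intCast_padic_eq ⟨u, hu⟩ hw'
    have hsv := Padic.norm_eq_zpow_neg_valuation hs0
    have hw2 : (w : ℤ) = 2 * s.valuation := by
      have : ((3 : ℕ) : ℝ) ^ (-(w : ℤ)) = ((3 : ℕ) : ℝ) ^ (-s.valuation + -s.valuation) := by
        rw [zpow_add₀ (by norm_num), ← hsv, ← norm_mul, ← hs]; exact_mod_cast hnn.symm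
      have hinj := (zpow_right_injective₀ (a := ((3 : ℕ) : ℝ)) (by norm_num) (by norm_num)) this
      omega
    refine ⟨by omega, ?_⟩
    -- unit part: `u = (s / 3^v)²` with `‖s / 3^v‖ = 1`
    set v := s.valuation with hv
    set r : ℚ_[3] := s / (3 : ℚ_[3]) ^ v with hr
    have h3v : ((3 : ℚ_[3])) ^ v ≠ 0 := zpow_ne_zero _ (by norm_num)
    have hur : (u : ℚ_[3]) = r ^ 2 := by
      have hn' : (n : ℚ_[3]) = (3 : ℚ_[3]) ^ (w : ℤ) * u := by
        rw [hu]; push_cast; rw [zpow_natCast]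
      have : (u : ℚ_[3]) = (n : ℚ_[3]) / (3 : ℚ_[3]) ^ (w : ℤ) := by
        rw [hn', mul_div_cancel_left₀ _ (zpow_ne_zero _ (by norm_num))]
      rw [this, hs, hr, hw2, two_mul, zpow_add₀ (by norm_num : (3 : ℚ_[3]) ≠ 0), pow_two,
        div_mul_div_comm]
    have hrn : ‖r‖ = 1 := by
      have h3 : ‖(3 : ℚ_[3])‖ = 3⁻¹ := by exact_mod_cast Padic.norm_p (p := 3)
      rw [hr, norm_div, norm_zpow, hsv, h3, inv_zpow']
      push_cast
      exact div_self (zpow_ne_zero _ (by norm_num))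
    have hlt := norm_sq_sub_one_lt_one hrn
    rw [← hur, show (u : ℚ_[3]) - 1 = ((u - 1 : ℤ) : ℚ_[3]) by push_cast; ring,
      Padic.norm_intCast_lt_one_iff] at hlt
    omega
  · rintro ⟨hwe, hu1⟩
    have hlt : ‖(u : ℚ_[3]) - 1‖ < 1 := by
      rw [show (u : ℚ_[3]) - 1 = ((u - 1 : ℤ) : ℚ_[3]) by push_cast; ring,
        Padic.norm_intCast_lt_one_iff]
      omega
    obtain ⟨s, hs⟩ := isSquare_of_norm_sub_one_lt_one hlt
    obtain ⟨j, hj⟩ : ∃ j, w = 2 * j := ⟨w / 2, by omega⟩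
    refine ⟨(3 : ℚ_[3]) ^ j * s, ?_⟩
    rw [hu, hj]; push_cast; rw [hs]; ring

end Summit.BirchSwinnertonDyer.Rank1Residual.GaloisImage.LocalTorsion3

end
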